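import Summits.ABC.IUTFork.Conditional.AbcOfSGenuineMWindowDatum
import Summits.ABC.IUTFork.Cor312PilotIdelesMReadDeep
import Summits.ABC.IUTFork.LDHGenuinePerImageReyssat
import Literature.IUT.LogVolume.LogRadiusClosedForm
import Literature.IUT.LogVolume.LogRadiusBounds
import Literature.IUT.LogVolume.DifferentEstimatesCorollaries
import Literature.IUT.LogVolume.InitialThetaDataBadPlaceRamification
import Literature.IUT.LogVolume.GenuineThetaFieldTateRoot
import HarnessLib

/-!
# Branch C, M line — the Reyssat datum `λ = 2/23⁵` (abc triple `2 + 3¹⁰·109 = 23⁵`) at `l = 13` is M-SHALLOW at EVERY member of EVERY genuine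
# Θ-volume datum: the shallowness input `hshallow` of the M apex socket `not_hSHwBad_M_of_refuted` (p468391 §1) is a THEOREM there

C scoreboard (abc-iut-C-cert-3 gen 4, INTAKE / CERTS pen; row «C:M-WINDOW-REYSSAT», answering the R-W numerics lead's M-DEPTH census
2026-08-27T00:29:33Z: «Reyssat @ 13/17/19 = the one place in the known universe where the M window socket could fire»). PROOF-ONLY (no `def`,
no new `Prop`, no instance, no notation; nothing re-typed). Part 1 of 2 (the apex composition is `AbcOfSHwBadMReyssatApex`).

* §1 classical lower bounds for the packet constants of a `p`-adic field ([IUTchIV] Prop. 1.2 `d, a, b`): `ReyssatM.logRadiusB_ge_of_pow_le`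
  (`p^k(p−1) ≤ p·e ⟹ b ≥ k − 1/e`), `ReyssatM.depthConstants_ge` (`d + a + b ≥ 1 + k − 1/e₀` for `e ≥ e₀`), `ReyssatM.depthConstants_ge_three`
  (`p = 3`: `a = 1`, `d + a + b ≥ 2 + k − 2/e₀`); `ReyssatM.one_le_rpow_mul_rpow_pow` (the real-number core).
* §2 the `j`-invariant dictionary of `λ = 2/23⁵` (abc-iut-s2-p4's `Cor22.jInv_reyssat` + abc-iut-c312-d1's `ord_jInv_ratPoint_*`): poles exactly over
  `3, 23, 109` with orders `20, 10, 2`.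
* §3 **`ReyssatM.not_exists_deep_thirteen`** — for EVERY `T : ThetaVolumeDatumAt (ratPoint (2/23⁵)) 13`, NO `(u, i, x₀)` is M-deep:
  `p_u^{((i+2)(d+a+b)+1)}·‖t_{q,x₀}‖^{(i+1)²−1} ≥ 1` at every member (good members: `‖t‖ = 1`; bad members: `p ∈ {3, 23, 109}`, `‖t‖ = p^{−h_p/26}`,
  `13 ∣ e` by [IUTchI] Ex. 3.2 (iv), over `23` moreover `39 ∣ e` by the Tate root `t = 5` (abc-iut-W-neg-1 / `fifteen_dvd_ramificationIdx_mul`) — so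
  `d + a + b ≥ 50/13 | 77/39 | 12/13` and the 18 label inequalities are integer arithmetic; tightest: over `3` at the top label, `726 ≥ 700`).
  This is the NEGATION of the depth antecedent of the M window binders (p445989 / p453767 / p461893) at every member, i.e. the socket's `hshallow`.

HONEST FRAMING: a statement about OUR sharp M setting's explicit `(d, a, b)` depth form at one rational datum; nothing here asserts that abc is proved
or refuted, or that [IUTchIII] Cor. 3.12 / Thm. 3.11 or [IUTchIV] Thm. 1.10 holds or fails, or takes a side on any author (Mochizuki / Scholze–Stix /
Joshi / Dupuy–Hilado); typed ≠ proved; instantiated ≠ endorsed. [cite: Mochizuki2012, IUTchI Def. 3.1 (b)(c) p. 61–62, Ex. 3.2 (iv) p. 71; IUTchIII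
Cor. 3.12 Step (xi-f) p. 184; IUTchIV Prop. 1.2 (i)(ii) p. 10, Cor. 2.2 (ii) proof (P5) p. 46] [cite: DupuyHilado2025, §3.3, §3.4]
[cite: SerreLocalFields1979, Ch. III §6 Prop. 13] [claim: Mochizuki2012, status: disputed] for every IUT sentence quoted.
-/

noncomputable section

open Set Function NumberField IsDedekindDomain

namespace Summit.ABC.IUTFork.Conditional

open Thm311 Thm311.Real Cor312 Cor312Vol Cor312Prov Literature.IUT.LogThetaLattice Literature.IUT.LogVolume
  Literature.IUT.HodgeTheaters Literature.IUT.LogVolume.ThetaData Literature.IUT.LogVolume.Cor22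
open Literature.NumberTheory.NumberFields Literature.NumberTheory.GaloisRepresentations.Ultrametric
open Literature.NumberTheory.DiophantineGeometry Literature.NumberTheory.DiophantineGeometry.GenEll Summit.ABC.ABC.Theorems

/-! ## §1. Depth-constant LOWER bounds for a `p`-adic field (classical; [IUTchIV] Prop. 1.2 constants `d, a, b`) -/

/-- **Lower window for `b`**: `p^k·(p−1) ≤ p·e ⟹ k − 1/e ≤ b = ⌊log(p·e/(p−1))/log p⌋ − 1/e`. [cite: Mochizuki2012, IUTchIV Prop. 1.2 p. 10]
[claim: Mochizuki2012, status: disputed] -/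
theorem ReyssatM.logRadiusB_ge_of_pow_le {p e k : ℕ} (hp : 1 < p) (he : 1 ≤ e) (hlo : p ^ k * (p - 1) ≤ p * e) :
    (k : ℝ) - 1 / e ≤ logRadiusB p e := by
  have hp1 : (1 : ℝ) < p := by exact_mod_cast hp
  have hp0 : (0 : ℝ) < p := by linarith
  have hp1' : (0 : ℝ) < (p : ℝ) - 1 := by linarith
  have he' : (0 : ℝ) < e := by exact_mod_cast he
  set x : ℝ := (p : ℝ) * e / ((p : ℝ) - 1) with hx
  have hx0 : 0 < x := div_pos (mul_pos hp0 he') hp1'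
  have hlo' : (p : ℝ) ^ k ≤ x := by
    rw [hx, le_div_iff₀ hp1']
    have h : ((p ^ k * (p - 1) : ℕ) : ℝ) ≤ ((p * e : ℕ) : ℝ) := by exact_mod_cast hlo
    rw [Nat.cast_mul, Nat.cast_pow, Nat.cast_sub hp.le, Nat.cast_one, Nat.cast_mul] at h
    exact h
  have hfloor : (k : ℤ) ≤ ⌊Real.log x / Real.log p⌋ := by
    rw [Real.log_div_log, Int.le_floor, Int.cast_natCast, Real.le_logb_iff_rpow_le hp1 hx0, Real.rpow_natCast]
    exact hlo'
  have hcast : (k : ℝ) ≤ (⌊Real.log x / Real.log p⌋ : ℝ) := by exact_mod_cast hfloor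
  unfold logRadiusB
  rw [← hx]
  linarith

section PadicField

variable (p : ℕ) [hp : Fact p.Prime] (K₀ : Type) [NontriviallyNormedField K₀] [NormedAlgebra ℚ_[p] K₀] [IsUltrametricDist K₀] [ProperSpace K₀]

/-- **`d + a + b ≥ 1 + k − 1/e₀`** for a `p`-adic field whose ramification index `e ≥ e₀ ≥ 1` satisfies `p^k·(p−1) ≤ p·e₀`: `d ≥ (e−1)/e` (Serre III §6),
`a ≥ 1/e`, `b ≥ k − 1/e`. [cite: Mochizuki2012, IUTchIV Prop. 1.2 p. 10] [cite: SerreLocalFields1979, Ch. III §6 Prop. 13] [claim: Mochizuki2012, status: disputed] -/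
theorem ReyssatM.depthConstants_ge {e₀ k : ℕ} (he₀ : 1 ≤ e₀) (hle : e₀ ≤ absRamificationIdx p K₀) (hlo : p ^ k * (p - 1) ≤ p * e₀) :
    (1 : ℝ) + k - 1 / e₀ ≤ differentOrd p K₀ + logRadiusA p (absRamificationIdx p K₀) + logRadiusB p (absRamificationIdx p K₀) := by
  set e := absRamificationIdx p K₀ with hedef
  have he : 1 ≤ e := le_trans he₀ hle
  have hpp : 1 < p := hp.out.one_lt
  have hd : ((e : ℝ) - 1) / e ≤ differentOrd p K₀ := sub_one_div_le_differentOrd p K₀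
  have ha : 1 / (e : ℝ) ≤ logRadiusA p e := one_div_le_logRadiusA hp.out he
  have hb : (k : ℝ) - 1 / e ≤ logRadiusB p e :=
    ReyssatM.logRadiusB_ge_of_pow_le hpp he (le_trans hlo (Nat.mul_le_mul_left p hle))
  have he0 : (0 : ℝ) < e := by exact_mod_cast (show 0 < e by omega)
  have he₀0 : (0 : ℝ) < e₀ := by exact_mod_cast (show 0 < e₀ by omega)
  have hinv : 1 / (e : ℝ) ≤ 1 / e₀ := one_div_le_one_div_of_le he₀0 (by exact_mod_cast hle)
  have hsum : ((e : ℝ) - 1) / e + 1 / e + ((k : ℝ) - 1 / e) = 1 + k - 1 / e := by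
    field_simp
    ring
  linarith [hd, ha, hb, hsum, hinv]

/-- **`p = 3`: `d + a + b ≥ 2 + k − 2/e₀`** (`a = 1` exactly since `p − 2 = 1`; `d ≥ (e−1)/e`; `b ≥ k − 1/e`) whenever `e ≥ e₀ ≥ 1` and `3^k·2 ≤ 3·e₀`.
[cite: Mochizuki2012, IUTchIV Prop. 1.2 p. 10] [cite: SerreLocalFields1979, Ch. III §6 Prop. 13] [claim: Mochizuki2012, status: disputed] -/
theorem ReyssatM.depthConstants_ge_three (h3 : p = 3) {e₀ k : ℕ} (he₀ : 1 ≤ e₀) (hle : e₀ ≤ absRamificationIdx p K₀)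
    (hlo : 3 ^ k * 2 ≤ 3 * e₀) :
    (2 : ℝ) + k - 2 / e₀ ≤ differentOrd p K₀ + logRadiusA p (absRamificationIdx p K₀) + logRadiusB p (absRamificationIdx p K₀) := by
  set e := absRamificationIdx p K₀ with hedef
  have he : 1 ≤ e := le_trans he₀ hle
  have hd : ((e : ℝ) - 1) / e ≤ differentOrd p K₀ := sub_one_div_le_differentOrd p K₀
  have ha : logRadiusA p e = (e : ℝ) / e := by
    rw [h3]
    exact logRadiusA_eq_of_window (p := 3) (c := e) (by norm_num) he (by omega) (by omega)
  have he0 : (0 : ℝ) < e := by exact_mod_cast (show 0 < e by omega)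
  have ha1 : logRadiusA p e = 1 := by rw [ha, div_self he0.ne']
  have hb : (k : ℝ) - 1 / e ≤ logRadiusB p e := by
    have hlo' : p ^ k * (p - 1) ≤ p * e := by
      rw [h3]
      exact le_trans (by simpa using hlo) (Nat.mul_le_mul_left 3 hle)
    exact ReyssatM.logRadiusB_ge_of_pow_le (by rw [h3]; norm_num) he hlo'
  have he₀0 : (0 : ℝ) < e₀ := by exact_mod_cast (show 0 < e₀ by omega)
  have hinv : 1 / (e : ℝ) ≤ 1 / e₀ := one_div_le_one_div_of_le he₀0 (by exact_mod_cast hle)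
  have hsum : ((e : ℝ) - 1) / e = 1 - 1 / e := by field_simp
  have h2 : (2 : ℝ) / e₀ = 2 * (1 / e₀) := by ring
  rw [ha1]
  linarith [hd, hb, hsum, hinv, h2]

end PadicField

/-- **The real-number core**: for `p ≥ 1` and `0 ≤ x + y·N`, `1 ≤ p^x · (p^y)^N`. [folklore] -/
theorem ReyssatM.one_le_rpow_mul_rpow_pow {p : ℝ} (hp : 1 ≤ p) {x y : ℝ} {N : ℕ} (h : 0 ≤ x + y * N) :
    1 ≤ p ^ x * (p ^ y) ^ N := by
  have hp0 : 0 < p := by linarith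
  rw [← Real.rpow_natCast, ← Real.rpow_mul hp0.le, ← Real.rpow_add hp0]
  calc (1 : ℝ) = p ^ (0 : ℝ) := (Real.rpow_zero p).symm
    _ ≤ p ^ (x + y * N) := Real.rpow_le_rpow_of_exponent_le hp h

/-! ## §2. The Reyssat point's `j`-invariant dictionary: poles exactly at `3, 23, 109` with orders `20, 10, 2` -/

/-- The primes of the reduced denominator of `j(2/23⁵)`. [folklore] -/
theorem ReyssatM.primes_of_mem : ∀ p ∈ ({3, 23, 109} : Finset ℕ), p.Prime := by
  intro p hp
  simp only [Finset.mem_insert, Finset.mem_singleton] at hp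
  rcases hp with rfl | rfl | rfl <;> norm_num

/-- `3²⁰·23¹⁰·109²` factorised. [folklore] -/
theorem ReyssatM.denominator_eq_prod :
    (1716154764793810191403767369 : ℕ) = ∏ p ∈ ({3, 23, 109} : Finset ℕ), p ^ (fun p : ℕ => if p = 3 then 20 else if p = 23 then 10 else 2) p := by
  rw [Finset.prod_insert (by decide), Finset.prod_insert (by decide), Finset.prod_singleton]
  norm_num

/-- `j(2/23⁵)` as a reduced fraction of naturals, at the datum spelling `((2 : ℕ) : ℚ) / (23 ^ 5 : ℕ)` (abc-iut-s2-p4's `Cor22.jInv_reyssat`).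
[cite: SilvermanAEC2009, Prop. III.1.7(b)] -/
theorem ReyssatM.jInv_eq : Cor22.jInv (((2 : ℕ) : ℚ) / (23 ^ 5 : ℕ)) =
    ((4550034081061575630856781958829776704708032 : ℕ) : ℚ) / ((1716154764793810191403767369 : ℕ) : ℚ) := by
  have h : (((2 : ℕ) : ℚ) / (23 ^ 5 : ℕ)) = (2 : ℚ) / 6436343 := by norm_num
  rw [h]
  exact Cor22.jInv_reyssat

/-- The numerator is non-zero. [folklore] -/
theorem ReyssatM.numerator_ne_zero : (4550034081061575630856781958829776704708032 : ℕ) ≠ 0 := by norm_num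

/-- The numerator is prime to `3, 23, 109`. [folklore] -/
theorem ReyssatM.not_dvd_numerator : ∀ p ∈ ({3, 23, 109} : Finset ℕ), ¬ p ∣ (4550034081061575630856781958829776704708032 : ℕ) := by
  intro p hp
  simp only [Finset.mem_insert, Finset.mem_singleton] at hp
  rcases hp with rfl | rfl | rfl <;> norm_num

/-- **`ord_v j(2/23⁵) ≥ 0` off `{3, 23, 109}`.** [cite: MochizukiGenEll2010, Def. 3.3 p. 12] -/
theorem ReyssatM.ord_jInv_nonneg_of_not_mem (v : HeightOneSpectrum (𝓞 ℚ))
    (hv : Rat.HeightOneSpectrum.natGenerator v ∉ ({3, 23, 109} : Finset ℕ)) :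
    0 ≤ ord ℚ v (Cor22.jInv (((2 : ℕ) : ℚ) / (23 ^ 5 : ℕ))) :=
  ord_jInv_ratPoint_nonneg_of_not_mem ReyssatM.primes_of_mem ReyssatM.denominator_eq_prod ReyssatM.jInv_eq ReyssatM.numerator_ne_zero v hv

/-- **`ord_v j(2/23⁵) = −20, −10, −2` at the places over `3, 23, 109`.** [cite: MochizukiGenEll2010, Def. 3.3 p. 12] -/
theorem ReyssatM.ord_jInv_of_mem (v : HeightOneSpectrum (𝓞 ℚ))
    (hv : Rat.HeightOneSpectrum.natGenerator v ∈ ({3, 23, 109} : Finset ℕ)) :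
    ord ℚ v (Cor22.jInv (((2 : ℕ) : ℚ) / (23 ^ 5 : ℕ))) =
      -((if Rat.HeightOneSpectrum.natGenerator v = 3 then 20 else if Rat.HeightOneSpectrum.natGenerator v = 23 then 10 else 2 : ℕ) : ℤ) :=
  ord_jInv_ratPoint_of_mem ReyssatM.primes_of_mem ReyssatM.denominator_eq_prod ReyssatM.jInv_eq ReyssatM.numerator_ne_zero v hv
    (ReyssatM.not_dvd_numerator _ hv)

/-! ## §3. Every member of every genuine Θ-volume datum over `(ratPoint (2/23⁵), 13)` is M-SHALLOW -/

/-- **M-SHALLOWNESS AT THE REYSSAT DATUM, `l = 13` — the socket input `hshallow` of `not_hSHwBad_M_of_refuted` (p468391 §1) as a THEOREM.**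
For EVERY genuine Θ-volume datum `T` over `(ratPoint (2/23⁵), 13)`, EVERY finite place `u` of `ℚ`, EVERY label `i + 1 ≤ l⋆ = 6` and EVERY
member `x₀ ∈ V̲_u` of the M-fibre: `p_u^{((i+2)·(d+a+b)+1)} · ‖t_{q,x₀}‖^{(i+1)²−1} ≥ 1` (`d, a, b` the packet constants of `K_{v̲(x₀)}`,
`t_{q,x₀}` the datum's OWN read-off q-idele). Proof: at a GOOD member `‖t_{q,x₀}‖ = 1` (abc-iut-w5-d033) and the exponent is `≥ 1`
(`d + a + b ≥ 0`, abc-iut-C-cert-2's `GenuineMShrink2.depthConstants_nonneg`); at a BAD member `‖t_{q,x₀}‖ = p^{ord_p j(λ)/(2l)}`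
(abc-iut-w5-d166's `norm_tqM_eq_rpow_ord_rat`), so `p ∈ {3, 23, 109}` with `ord_p j = −20, −10, −2` (§2), `13 ∣ e` at every bad place
([IUTchI] Ex. 3.2 (iv), `ThetaData.l_dvd_absRamificationIdx_of_under_mem_VFbad`), and over `23` moreover `3 ∣ e(w_F | 23)` (Tate root `t = 5`,
`ThetaVolumeDatumAt.fifteen_dvd_ramificationIdx_mul`) so `39 ∣ e`; the lower bounds of §1 then give `d + a + b ≥ 50/13` over `3`, `≥ 77/39` over
`23`, `≥ 12/13` over `109`, and the six label inequalities per prime are integer arithmetic (tightest: over `3` at the top label,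
`26·(7·50/13 + 1) = 726 ≥ 700 = 20·35`). A statement about OUR sharp M setting's explicit depth form; nothing about print.
[cite: Mochizuki2012, IUTchI Def. 3.1 (b)(c) p. 61–62, Ex. 3.2 (iv) p. 71; IUTchIV Prop. 1.2 (i)(ii) p. 10, Cor. 2.2 (ii) proof (P5) p. 46]
[cite: DupuyHilado2025, §3.3, §3.4] [cite: SerreLocalFields1979, Ch. III §6 Prop. 13] [claim: Mochizuki2012, status: disputed] -/
theorem ReyssatM.not_exists_deep_thirteen (T : Cor22.ThetaVolumeDatumAt (ratPoint (((2 : ℕ) : ℚ) / (23 ^ 5 : ℕ))) 13) :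
    letI := T.instFieldF; letI := T.instNumberFieldF; letI := T.instAlgebraF; letI := T.instFieldK
    letI := T.instNumberFieldK; letI := T.instAlgebraK; letI := T.instFieldFbar; letI := T.instAlgebraFbar
    letI := T.instAlgebraKFbar; letI := T.instIsElliptic
    ¬ (∃ (u : FinitePlace ℚ) (i : Fin (thetaIndexOfInitial T.D).lstar) (x₀ : (thetaIndexOfInitial T.D).Fibre (Val.non u)),
      ((ratChar u : ℕ) : ℝ) ^ ((((i : ℕ) : ℝ) + 2) *
      (differentOrd (ratChar u) (kOfM T.D (ratChar u) u (natCast_ratChar_mem u) x₀)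
      + logRadiusA (ratChar u) (absRamificationIdx (ratChar u) (kOfM T.D (ratChar u) u (natCast_ratChar_mem u) x₀))
      + logRadiusB (ratChar u) (absRamificationIdx (ratChar u) (kOfM T.D (ratChar u) u (natCast_ratChar_mem u) x₀))) + 1) *
      ‖tqM T.D (ratChar u) u (natCast_ratChar_mem u) (ideleDataOf T.D T.isVolumeInputOf) x₀‖ ^ (((i : ℕ) + 1) ^ 2 - 1) < 1) := by
  classical
  letI := T.instFieldF; letI := T.instNumberFieldF; letI := T.instAlgebraF; letI := T.instFieldK
  letI := T.instNumberFieldK; letI := T.instAlgebraK; letI := T.instFieldFbar; letI := T.instAlgebraFbar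
  letI := T.instAlgebraKFbar; letI := T.instIsElliptic
  rintro ⟨u, i, x₀, hlt⟩
  revert hlt
  rw [imp_false, not_lt]
  set p : ℕ := ratChar u with hpdef
  haveI hpfact : Fact p.Prime := inferInstance
  have hp1 : (1 : ℝ) ≤ (p : ℝ) := by exact_mod_cast hpfact.out.one_lt.le
  have hp1' : (1 : ℝ) < (p : ℝ) := by exact_mod_cast hpfact.out.one_lt
  set K₀ := kOfM T.D p u (natCast_ratChar_mem u) x₀ with hK₀def
  set r := ideleDataOf T.D T.isVolumeInputOf with hrdef
  have hdab : 0 ≤ differentOrd p K₀ + logRadiusA p (absRamificationIdx p K₀) + logRadiusB p (absRamificationIdx p K₀) :=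
    GenuineMShrink2.depthConstants_nonneg p K₀
  -- the label: `i ≤ 5`
  have hlstar : (thetaIndexOfInitial T.D).lstar = (13 - 1) / 2 := rfl
  have hi5 : (i : ℕ) ≤ 5 := by
    have h : (i : ℕ) < (thetaIndexOfInitial T.D).lstar := i.2
    have h' : (thetaIndexOfInitial T.D).lstar = 6 := hlstar
    omega
  have hi0 : (0 : ℝ) ≤ ((i : ℕ) : ℝ) + 2 := by positivity
  have hexpo : (1 : ℝ) ≤ (((i : ℕ) : ℝ) + 2) *
      (differentOrd p K₀ + logRadiusA p (absRamificationIdx p K₀) + logRadiusB p (absRamificationIdx p K₀)) + 1 := by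
    nlinarith only [hdab, hi0]
  by_cases hx : placeModOfM T.D u x₀ ∈ (ThetaData.pilotData T.D).S
  · -- BAD member: `‖t_{q,x₀}‖ = p^{ord_p j(λ)/(2l)}` with `ord_p j(λ) < 0`
    have hjF : T.E.j = ((Cor22.jInv (((2 : ℕ) : ℚ) / (23 ^ 5 : ℕ)) : ℚ) : T.F) := by
      rw [T.j_eq]; exact eq_ratCast _ _
    have hnorm := norm_tqM_eq_rpow_ord_rat T.D p u (natCast_ratChar_mem u) r x₀ hx (Cor22.jInv (((2 : ℕ) : ℚ) / (23 ^ 5 : ℕ))) hjF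
    have hlt1 := norm_tqM_lt_one T.D p u (natCast_ratChar_mem u) r x₀ hx
    set v : HeightOneSpectrum (𝓞 ℚ) := Literature.IUT.LogVolume.finBelow ℚ (fieldOfModuli T.E) (placeModOfM T.D u x₀) with hvdef
    have hvp : Rat.HeightOneSpectrum.natGenerator v = p := natGenerator_finBelow_placeModOfM T.D p u (natCast_ratChar_mem u) x₀
    -- `ord_v j(λ) < 0`
    have hord_neg : ord ℚ v (Cor22.jInv (((2 : ℕ) : ℚ) / (23 ^ 5 : ℕ))) < 0 := by
      by_contra hge
      rw [not_lt] at hge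
      have hge' : (0 : ℝ) ≤ (ord ℚ v (Cor22.jInv (((2 : ℕ) : ℚ) / (23 ^ 5 : ℕ))) : ℝ) := by exact_mod_cast hge
      have hexp : (0 : ℝ) ≤ (ord ℚ v (Cor22.jInv (((2 : ℕ) : ℚ) / (23 ^ 5 : ℕ))) : ℝ) / (2 * ((13 : ℕ) : ℝ)) := by positivity
      have h1 : (1 : ℝ) ≤ ‖tqM T.D p u (natCast_ratChar_mem u) r x₀‖ := by
        rw [hnorm]
        exact Real.one_le_rpow hp1 hexp
      linarith
    -- hence `p ∈ {3, 23, 109}` and the exact pole order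
    have hmem : p ∈ ({3, 23, 109} : Finset ℕ) := by
      by_contra hnot
      exact absurd (ReyssatM.ord_jInv_nonneg_of_not_mem v (by rw [hvp]; exact hnot)) (not_le.mpr hord_neg)
    have hord := ReyssatM.ord_jInv_of_mem v (by rw [hvp]; exact hmem)
    rw [hvp] at hord
    -- local type at the member: `13 ∣ e`
    set w := placeOfM T.D u x₀ with hwdef
    have hpw : ((p : ℕ) : 𝓞 T.K) ∈ w.asIdeal := natCast_mem_placeOfM T.D p u (natCast_ratChar_mem u) x₀
    have hwchar : residueChar T.K w = p := residueChar_eq_of_natCast_mem p hpw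
    have heK : absRamificationIdx p K₀ = w.asIdeal.ramificationIdx ℤ := absRamificationIdx_rescaledCompletion T.K p w hpw
    have hp2 : p ≠ 2 := by
      simp only [Finset.mem_insert, Finset.mem_singleton] at hmem; omega
    have hpl : p ≠ 13 := by
      simp only [Finset.mem_insert, Finset.mem_singleton] at hmem; omega
    have hpole : ∀ w' : HeightOneSpectrum (𝓞 ℚ), residueChar ℚ w' = p → ord ℚ w' (Cor22.jInv (((2 : ℕ) : ℚ) / (23 ^ 5 : ℕ))) < 0 := by
      intro w' hw'
      have hmem' : ((p : ℕ) : 𝓞 ℚ) ∈ w'.asIdeal := (Cor22.natCast_mem_asIdeal_iff_residueChar_eq w' hpfact.out).mpr hw'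
      have hgen : Rat.HeightOneSpectrum.natGenerator w' = p :=
        (Nat.prime_dvd_prime_iff_eq (Rat.HeightOneSpectrum.prime_natGenerator w') hpfact.out).mp
          ((UniformABCConjecture.natCast_mem_asIdeal_iff w' p).mp hmem')
      have h := ReyssatM.ord_jInv_of_mem w' (by rw [hgen]; exact hmem)
      rw [h, hgen]
      simp only [Finset.mem_insert, Finset.mem_singleton] at hmem
      rcases hmem with h3 | h23 | h109
      · rw [h3]; norm_num
      · rw [h23]; norm_num
      · rw [h109]; norm_num
    have hS : w ∈ (pilotDataOfK T.D T.K).S := Hex.mem_S_of_forall_ord_jInv_neg T hp2 hpl hpole w hwchar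
    have hVF := (mem_pilotDataOfK_S_iff T.D T.K w).mp hS
    have hl_dvd : 13 ∣ w.asIdeal.ramificationIdx ℤ := ThetaData.l_dvd_absRamificationIdx_of_under_mem_VFbad T.D hVF
    have he13 : 13 ≤ absRamificationIdx p K₀ := by
      rw [heK]; exact Nat.le_of_dvd (Ideal.ramificationIdx_pos _ _) hl_dvd
    -- the goal, with the norm rewritten
    rw [hnorm]
    apply ReyssatM.one_le_rpow_mul_rpow_pow hp1
    have hN : ((((i : ℕ) + 1) ^ 2 - 1 : ℕ) : ℝ) = (((i : ℕ) : ℝ) + 1) ^ 2 - 1 := by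
      rw [Nat.cast_sub (Nat.one_le_pow _ _ (by omega))]; push_cast; ring
    rw [hN]
    simp only [Finset.mem_insert, Finset.mem_singleton] at hmem
    rcases hmem with h3 | h23 | h109
    · -- over `3`: `ord = −20`, `d + a + b ≥ 50/13`
      have hd3 := ReyssatM.depthConstants_ge_three p K₀ h3 (e₀ := 13) (k := 2) (by norm_num) he13 (by norm_num)
      have hordv : (ord ℚ v (Cor22.jInv (((2 : ℕ) : ℚ) / (23 ^ 5 : ℕ))) : ℝ) = -20 := by
        rw [hord, h3]; norm_num
      rw [hordv]
      have hmul := mul_le_mul_of_nonneg_left hd3 hi0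
      set D := differentOrd p K₀ + logRadiusA p (absRamificationIdx p K₀) + logRadiusB p (absRamificationIdx p K₀) with hD
      set n : ℕ := (i : ℕ) with hn
      interval_cases n <;> · norm_num at hmul ⊢; linarith only [hmul]
    · -- over `23`: `ord = −10`, `39 ∣ e`, `d + a + b ≥ 77/39`
      have hordv23 : (ord ℚ v (Cor22.jInv (((2 : ℕ) : ℚ) / (23 ^ 5 : ℕ))) : ℝ) = -10 := by
        rw [hord, h23]; norm_num
      -- `3 ∣ e(w_F | 23)` by the Tate root `t = 5`
      set wF := Literature.IUT.LogVolume.finBelow T.F T.K w with hwFdef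
      set vF : HeightOneSpectrum (𝓞 ℚ) := Literature.IUT.LogVolume.finBelow (ratPoint (((2 : ℕ) : ℚ) / (23 ^ 5 : ℕ))).F T.F wF with hvFdef
      have hvF : Rat.HeightOneSpectrum.natGenerator vF = p := by
        have hchar : residueChar ℚ vF = p := by
          rw [hvFdef]
          change residueChar (ratPoint (((2 : ℕ) : ℚ) / (23 ^ 5 : ℕ))).F
            (Literature.IUT.LogVolume.finBelow (ratPoint (((2 : ℕ) : ℚ) / (23 ^ 5 : ℕ))).F T.F (Literature.IUT.LogVolume.finBelow T.F T.K w)) = p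
          rw [residueChar_finBelow, residueChar_finBelow, hwchar]
        have hmemv : ((p : ℕ) : 𝓞 ℚ) ∈ vF.asIdeal := (Cor22.natCast_mem_asIdeal_iff_residueChar_eq vF hpfact.out).mpr hchar
        exact (Nat.prime_dvd_prime_iff_eq (Rat.HeightOneSpectrum.prime_natGenerator vF) hpfact.out).mp
          ((UniformABCConjecture.natCast_mem_asIdeal_iff vF p).mp hmemv)
      have hordv : ord ℚ vF (Cor22.jInv (((2 : ℕ) : ℚ) / (23 ^ 5 : ℕ))) = -(2 * ((5 : ℕ) : ℤ)) := by
        have h := ReyssatM.ord_jInv_of_mem vF (by rw [hvF, h23]; decide)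
        rw [hvF, h23] at h
        rw [h]; norm_num
      have hordF : ord (ratPoint (((2 : ℕ) : ℚ) / (23 ^ 5 : ℕ))).F
          (Literature.IUT.LogVolume.finBelow (ratPoint (((2 : ℕ) : ℚ) / (23 ^ 5 : ℕ))).F T.F wF)
          (Cor22.jInv (ratPoint (((2 : ℕ) : ℚ) / (23 ^ 5 : ℕ))).x) = -(2 * ((5 : ℕ) : ℤ)) := hordv
      have h15 : 15 ∣ wF.asIdeal.ramificationIdx (𝓞 (ratPoint (((2 : ℕ) : ℚ) / (23 ^ 5 : ℕ))).F) * 5 :=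
        T.fifteen_dvd_ramificationIdx_mul wF hordF (by norm_num)
      have h3F : 3 ∣ wF.asIdeal.ramificationIdx (𝓞 (ratPoint (((2 : ℕ) : ℚ) / (23 ^ 5 : ℕ))).F) := by
        have h35 : Nat.Coprime 3 5 := by decide
        exact h35.dvd_of_dvd_mul_right (dvd_trans (by norm_num : (3 : ℕ) ∣ 15) h15)
      -- `e(wF | ℤ) = e(wF | 𝓞 ℚ)` and `e(w | ℤ) = e(wF | ℤ) · e(w | wF)` with `13 ∣ e(w | wF)`
      have hewF : wF.asIdeal.ramificationIdx ℤ = wF.asIdeal.ramificationIdx (𝓞 (ratPoint (((2 : ℕ) : ℚ) / (23 ^ 5 : ℕ))).F) := by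
        haveI : (Literature.IUT.LogVolume.finBelow (ratPoint (((2 : ℕ) : ℚ) / (23 ^ 5 : ℕ))).F T.F wF).asIdeal.IsMaximal :=
          (Literature.IUT.LogVolume.finBelow (ratPoint (((2 : ℕ) : ℚ) / (23 ^ 5 : ℕ))).F T.F wF).isMaximal
        have h1 : ramIdx (ratPoint (((2 : ℕ) : ℚ) / (23 ^ 5 : ℕ))).F (wF.under (𝓞 (ratPoint (((2 : ℕ) : ℚ) / (23 ^ 5 : ℕ))).F)) = 1 := by
          rw [ramIdx_eq]
          exact Literature.NumberTheory.EllipticCurves.Fisher2016.ramificationIdx_int_rat_eq_one _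
        rw [ThetaData.absRamificationIdx_eq_ramIdx_mul (F := (ratPoint (((2 : ℕ) : ℚ) / (23 ^ 5 : ℕ))).F) wF]
        erw [h1, one_mul]
        exact Ideal.ramificationIdx'_eq_ramificationIdx (Literature.IUT.LogVolume.finBelow (ratPoint (((2 : ℕ) : ℚ) / (23 ^ 5 : ℕ))).F T.F wF).asIdeal wF.asIdeal
          (Literature.IUT.LogVolume.finBelow (ratPoint (((2 : ℕ) : ℚ) / (23 ^ 5 : ℕ))).F T.F wF).ne_bot
      have hfac : w.asIdeal.ramificationIdx ℤ = ramIdx T.F (w.under (𝓞 T.F)) * Ideal.ramificationIdx' (w.under (𝓞 T.F)).asIdeal w.asIdeal :=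
        ThetaData.absRamificationIdx_eq_ramIdx_mul (F := T.F) w
      have hlrel : 13 ∣ Ideal.ramificationIdx' (w.under (𝓞 T.F)).asIdeal w.asIdeal :=
        ThetaData.l_dvd_ramificationIdx_of_under_mem_VFbad T.D hVF
      have h3w : 3 ∣ ramIdx T.F (w.under (𝓞 T.F)) := by
        rw [ramIdx_eq]
        change 3 ∣ wF.asIdeal.ramificationIdx ℤ
        rw [hewF]; exact h3F
      have h39 : 39 ∣ absRamificationIdx p K₀ := by
        rw [heK, hfac, show (39 : ℕ) = 3 * 13 by norm_num]
        exact mul_dvd_mul h3w hlrel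
      have he39 : 39 ≤ absRamificationIdx p K₀ :=
        Nat.le_of_dvd (lt_of_lt_of_le (by norm_num) he13) h39
      have hd23 := ReyssatM.depthConstants_ge p K₀ (e₀ := 39) (k := 1) (by norm_num) he39 (by rw [h23]; norm_num)
      rw [hordv23]
      have hmul := mul_le_mul_of_nonneg_left hd23 hi0
      set D := differentOrd p K₀ + logRadiusA p (absRamificationIdx p K₀) + logRadiusB p (absRamificationIdx p K₀) with hD
      set n : ℕ := (i : ℕ) with hn
      interval_cases n <;> · norm_num at hmul ⊢; linarith only [hmul]
    · -- over `109`: `ord = −2`, `d + a + b ≥ 12/13`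
      have hordv : (ord ℚ v (Cor22.jInv (((2 : ℕ) : ℚ) / (23 ^ 5 : ℕ))) : ℝ) = -2 := by
        rw [hord, h109]; norm_num
      have hd109 := ReyssatM.depthConstants_ge p K₀ (e₀ := 13) (k := 0) (by norm_num) he13 (by rw [h109]; norm_num)
      rw [hordv]
      have hmul := mul_le_mul_of_nonneg_left hd109 hi0
      set D := differentOrd p K₀ + logRadiusA p (absRamificationIdx p K₀) + logRadiusB p (absRamificationIdx p K₀) with hD
      set n : ℕ := (i : ℕ) with hn
      interval_cases n <;> · norm_num at hmul ⊢; linarith only [hmul]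
  · -- GOOD member: `‖t_{q,x₀}‖ = 1`
    rw [norm_tqM_eq_one_of_not_mem T.D p u (natCast_ratChar_mem u) r x₀ hx, one_pow, mul_one]
    exact Real.one_le_rpow hp1 (by linarith)

end Summit.ABC.IUTFork.Conditional

end
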